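import Summits.QuantumFields.YangMills.Theorems.BalabanUVNodesPortS1ChartJacobian
import Literature.MathematicalPhysics.QuantumFieldTheory.Balaban1983to89.B10Eq18SigmaSU2Chart

/-!
# NODE O port PT-A — socket (o2) = brick (h2), RIDER (f1) of ◆ CRIT-1 g38 (nodeO STATUS 2026-08-31T14:05:28Z): the one-bond Jacobian `chartJac` of ✓`…PortS1ChartJacobian` IDENTIFIED BY EQUATIONS with the
# tree's objects — p28's `jacDensity` of the `SU(2)` exponential chart at the Pauli coordinate `⟨iΣ_aA^aσ_a⟩` (`= ofReal (chartJac A)`), r10's Jacobian determinant `det jac` (`= chartJac A`), [Hel] (12)'s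
# `σrel(T_A) = det((1 − e^{−ad})∕ad)` (`= chartJac A` in `ℂ`), the normalisation `σ(|A|)∕σ(0)` displayed as the DEFINITION, and p28's chart `Θ` ∕ window `V_s` read as `chartAt` ∕ `chartAt u '' B_s`

Cell `ym-nodeO-ideate`, porter seat `ymgap-nodeO-port-PTA-1` (gen 9); `--kind proof --supports stmt-QuantumFields-27930 --as helper`.  Why a separate leaf: ✓`…PortS1ChartJacobian` imports only `B10Eq18SigmaSU2Haar` +
`T4HaarSU2Translate` (built on every farm node); the p28 bridge `B10Eq18SigmaSU2Chart` (r07 gen 25) is a heavier olean whose availability lagged on the check nodes this session — isolating it here keeps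
the three (o2) leaves importable regardless.  [16] = [Balaban1985UV3] (18) p.260; [Hel] = [Helgason2000] Ch. I §1 Thm. 1.14 (12)–(13) p.96; [I] = [Balaban1987RG1] (2.4) p.266, (2.10) p.267.

CONTENT (theorems only; no `def`, no `instance`, no `notation`, no `sorry`): `chartJac_def` (`rfl`: `chartJac A = σ_{SU(2)}(|A|)∕σ_{SU(2)}(0)`), ★ `det_jac_pauli_eq_chartJac`, ★ `jacDensity_pauli_eq_chartJac`,
`chartJac_eq_sigmaRel`, `expChart_pauli_eq_chartAt_one` ∕ `chartAt_eq_expChart_mul` (p28's `Θ` through the Pauli coordinates IS `chartAt`), `window_eq_image_chartAt_one`.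

HONEST FRAMING.  Identifications by name of already-certified one-bond facts (r07 `B10Eq18SigmaSU2Chart.det_jac_pauli` ∕ `jacDensity_pauli` ∕ `expChart_pauli`, r10 `B13HaarSigmaJacobian`); nothing
of Bałaban's renormalization-group estimates asserted, ported or discharged; `stub_P0C` ∕ `stub_FE` OPEN; ⟨27930⟩ ⁸-Ax-LR4 OPEN · no claim; NODE O 0∕1; COUNT 8∕28 · K 1∕4 UNMOVED; finite
`𝕋⁴_{L^K}` at fixed ε — NOT continuum ∕ OS ∕ Clay; **the Yang–Mills mass gap is NOT proved by any of this.**  Standard axioms.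
-/

noncomputable section

open MeasureTheory Set Metric
open scoped ENNReal Matrix.Norms.L2Operator

namespace Summit.QuantumFields.YangMills.Theorems.BalabanUVNodesPortS1

open Literature.MathematicalPhysics.QuantumLattice (fundamentalRep)
open Literature.MathematicalPhysics.QuantumFieldTheory.Balaban1983to89
open Literature.MathematicalPhysics.QuantumFieldTheory.Balaban1983to89.B10Eq22Rescaling (sigmaSU2 sigmaSU2_zero)
open Literature.MathematicalPhysics.QuantumFieldTheory.Balaban1983to89.B10Eq18SigmaSU2 (su2Coord crossMatrix)
open Literature.MathematicalPhysics.QuantumFieldTheory.Balaban1983to89.B10Eq18SigmaSU2Haar (expPauli sigmaSU2_ratio_eq_sigmaRel)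
open Literature.MathematicalPhysics.QuantumFieldTheory.Balaban1983to89.B10Eq18SigmaSU2Chart
open Literature.MathematicalPhysics.QuantumFieldTheory.Balaban1983to89.B13HaarSigma (sigmaRel)
open Literature.MathematicalPhysics.QuantumFieldTheory.Balaban1983to89.B13HaarSigmaJacobian (jac)
open HaarExponentialChart HaarExponentialChart.IsChartRep

/-- **THE NORMALISATION DISPLAYED** (`rfl`): `chartJac A = σ_{SU(2)}(|A|) ∕ σ_{SU(2)}(0)`, `σ_{SU(2)}(r) = (1∕2π²)(sin r∕r)²` (`B10Eq22Rescaling.sigmaSU2`), so `σ₀ = σ_{SU(2)}(0) = 1∕2π²`.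
[cite: Balaban1985UV3, (18) p.260] -/
theorem chartJac_def (A : EuclideanSpace ℝ (Fin 3)) : chartJac A = sigmaSU2 ‖A‖ / sigmaSU2 0 := rfl

/-- ★ **`chartJac` IS THE JACOBIAN DETERMINANT OF THE EXPONENTIAL CHART** ([Hel] Thm. 1.14 (13) `dμ = |det(d exp_X)| dX`): for r10's Jacobian endomorphism `jac` of the `SU(2)` chart at the Pauli
coordinate `X = iΣ_aA^aσ_a ∈ 𝔰𝔲(2) = C.lie`, `det jac(X) = chartJac A` (r07's `det_jac_pauli`). [cite: Helgason2000, Ch. I §1 Thm. 1.14 (13) p. 96] [cite: Balaban1985UV3, (18) p.260] -/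
theorem det_jac_pauli_eq_chartJac (A : EuclideanSpace ℝ (Fin 3)) :
    LinearMap.det (jac (lie_adStable_specialUnitaryGroup (n := Fin 2)) (⟨su2Coord A, su2Coord_mem_lie A⟩ : (specialUnitaryLogChart (Fin 2)).lie) :
      (specialUnitaryLogChart (Fin 2)).lie →ₗ[ℝ] (specialUnitaryLogChart (Fin 2)).lie) = chartJac A :=
  det_jac_pauli A

/-- ★ **p28's DENSITY `jacDensity = |det jac|` AT THE PAULI COORDINATE IS `ofReal (chartJac A)`** — the (f1) identification: the density of ✓`…PortS1ChartJacobian`'s window identities is, by an EQUATION,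
the framework density of ✓`HaarExponentialChart`∕✓`HaarExpChartChangeOfVariables` (`jacDensity (lie_adStable_specialUnitaryGroup)`), read through the Pauli coordinates (r07's `jacDensity_pauli`).
[cite: Helgason2000, Ch. I §1 Thm. 1.14 (13) p. 96] [cite: Balaban1985UV3, (18) p.260] -/
theorem jacDensity_pauli_eq_chartJac (A : EuclideanSpace ℝ (Fin 3)) :
    jacDensity (lie_adStable_specialUnitaryGroup (n := Fin 2)) (⟨su2Coord A, su2Coord_mem_lie A⟩ : (specialUnitaryLogChart (Fin 2)).lie) = ENNReal.ofReal (chartJac A) :=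
  jacDensity_pauli A

/-- [Hel] (12) `det((1 − e^{−ad X})∕ad X)`: `chartJac A = σrel(T_A)`, `T_A = 2[A]_×` the matrix of `−ad(iA)` in Pauli coordinates (r10's `sigmaRel`, r07's `sigmaSU2_ratio_eq_sigmaRel`).
[cite: Helgason2000, Ch. I §1 Thm. 1.14 (12) p. 96] [cite: Balaban1985UV3, (18) p.260] -/
theorem chartJac_eq_sigmaRel (A : EuclideanSpace ℝ (Fin 3)) :
    ((chartJac A : ℝ) : ℂ) = sigmaRel (((2 : ℝ) • crossMatrix (A : Fin 3 → ℝ)).map (algebraMap ℝ ℂ)) :=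
  sigmaSU2_ratio_eq_sigmaRel A

/-- **p28's CHART `Θ` THROUGH THE PAULI COORDINATES IS `chartAt 1`**: `Θ(iΣ_aA^aσ_a) = exp(iA) = chartAt 1 A`, for every chart-representation witness `h` (r07's `expChart_pauli`).
[cite: Balaban1985UV3, (18) p.260] [cite: Balaban1987RG1, (2.4) p.266] -/
theorem expChart_pauli_eq_chartAt_one (h : IsChartRep (specialUnitaryLogChart (Fin 2)) (fundamentalRep (Fin 2))) (A : EuclideanSpace ℝ (Fin 3)) :
    h.expChart ⟨su2Coord A, su2Coord_mem_lie A⟩ = chartAt 1 A := by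
  rw [expChart_pauli, chartAt_apply, mul_one]

/-- The translated chart in p28's letters: `chartAt u A = Θ(iΣ_aA^aσ_a) · u` ([I] (2.4) `V = V′V^{(k)}` on one bond). [cite: Balaban1987RG1, (2.4) p.266] [cite: Balaban1985UV3, (18) p.260] -/
theorem chartAt_eq_expChart_mul (h : IsChartRep (specialUnitaryLogChart (Fin 2)) (fundamentalRep (Fin 2))) (u : Matrix.specialUnitaryGroup (Fin 2) ℂ)
    (A : EuclideanSpace ℝ (Fin 3)) : chartAt u A = h.expChart ⟨su2Coord A, su2Coord_mem_lie A⟩ * u := by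
  rw [expChart_pauli, chartAt_apply]

/-- p28's window `V_s = Θ(B(0,s))` is the centred chart window `chartAt 1 '' B_s` (r07's `window_eq_image_expPauli`). [cite: Balaban1985UV3, (18) p.260] -/
theorem window_eq_image_chartAt_one (h : IsChartRep (specialUnitaryLogChart (Fin 2)) (fundamentalRep (Fin 2))) (s : ℝ) :
    h.window s = chartAt 1 '' ball (0 : EuclideanSpace ℝ (Fin 3)) s := by
  rw [window_eq_image_expPauli]
  refine congrArg (· '' _) (funext fun A => ?_)
  rw [chartAt_apply, mul_one]

end Summit.QuantumFields.YangMills.Theorems.BalabanUVNodesPortS1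

end
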